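import Mathlib
import Literature.Analysis.FluidPDE.Tao2016AveragedNS.ShiftSetCascadeFlows
import HarnessLib

/-!
# Exact symmetries of the cascade lattice on a shift set `𝕊`: amplitude–time scaling and time translation of
  exact flows (helper for item stmt-NavierStokesRegularity-22987 `FlatGapCertificatesV2`, crux K_A♭ of route
  TaoLadderRungTwoFlat; cell harvest/h2-tao-ladder, p1 g19)

The lattice `Ẋ = quadTermOn 𝕊 ε₀ α X` is autonomous and quadratic, so for EVERY scale ratio `1+ε₀`:

* SCALING: if `S` is an exact flow on `[0, τ]` from `S₀` then `t ↦ κ·S(κt)` is an exact flow on `[0, τ/κ]`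
  from `κ·S₀` (`κ > 0`) — `pseudoFlowOnShift_scale`. This is the neutral «scale» direction of every solitary
  wave / DSS profile (hop time `τ/κ`, amplitude `κ`: the cell's `a_peak · T_hop = const` check), and the
  reason the certificate format cannot hold AT `ε₀ = 0` (the floor `a ≥ 1` meets the exact symmetry
  `(1−δ)·z`; cell note TRANSFER-NOTES §4);
* TIME TRANSLATION: the tail `t ↦ S(s+t)` of an exact flow on `[0, τ]` is an exact flow on `[0, τ−s]` from
  `S(s)` — `pseudoFlowOnShift_translate` (the neutral «phase» direction).

Both at the level of the certificate predicate `PseudoFlowOnShift 𝕊 τ ε₀ α 0 0 S₀ (½S₀²) 0 S F` (exact,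
zero slack). Algebra used: `quadTermOn_scale_time` (`Q(κ·S∘φ)(t) = κ²·Q(S)(φ t)`).

HONEST FRAMING: change-of-variables facts about a MODEL lattice (Tao 2016 §4 vocabulary, shift-set
parametrised); nothing is certified here and nothing is a statement about the Navier–Stokes equations.
-/

noncomputable section

-- the sub-problem namespace repeats the summit name by design (D-0017)
set_option linter.dupNamespace false

namespace Summit.NavierStokesRegularity.NavierStokesRegularity.Theorems

open Set Literature.Analysis.FluidPDE Literature.Analysis.FluidPDE.TaoCascade

namespace FlowSymmetry

variable {m : ℕ}

/-- The scaled, time-compressed family `(κ·S∘(κ·))_{i,k}(t) = κ S_{i,k}(κt)`.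
[cite: Tao2016AveragedNS, §4 (4.8) (homogeneity of the nonlinearity); cell harvest/h2-tao-ladder] -/
def scaleFam (κ : ℝ) (S : Fin m → ℤ → ℝ → ℝ) : Fin m → ℤ → ℝ → ℝ := fun i k t => κ * S i k (κ * t)

/-- The time-translated family `S_{i,k}(s + t)`. [cite: Tao2016AveragedNS, §4 (4.8) (autonomy)] -/
def translateFam (s : ℝ) (S : Fin m → ℤ → ℝ → ℝ) : Fin m → ℤ → ℝ → ℝ := fun i k t => S i k (s + t)

/-- **Homogeneity of degree two with a time change**: `Q(t ↦ κ S(φ t))(t) = κ² · Q(S)(φ t)`.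
[cite: Tao2016AveragedNS, §4 (4.8)] -/
theorem quadTermOn_scale_time (𝕊 : Finset (ℤ × ℤ × ℤ)) (ε₀ : ℝ)
    (α : Fin m → Fin m → Fin m → ℤ × ℤ × ℤ → ℝ) (κ : ℝ) (S : Fin m → ℤ → ℝ → ℝ) (φ : ℝ → ℝ)
    (i : Fin m) (n : ℤ) (t : ℝ) :
    quadTermOn 𝕊 ε₀ α (fun j k u => κ * S j k (φ u)) i n t = κ ^ 2 * quadTermOn 𝕊 ε₀ α S i n (φ t) := by
  simp only [quadTermOn, Finset.mul_sum]
  refine Finset.sum_congr rfl fun _ _ => Finset.sum_congr rfl fun _ _ => Finset.sum_congr rfl fun _ _ => ?_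
  ring

/-! ### Calculus of the two reparametrisations on `[0, τ]` -/

/-- `u ↦ κu` maps `[0, τ/κ]` into `[0, τ]` (`κ > 0`). [folklore] -/
theorem mul_mem_Icc {κ τ u : ℝ} (hκ : 0 < κ) (hu : u ∈ Icc 0 (τ / κ)) : κ * u ∈ Icc 0 τ := by
  refine ⟨mul_nonneg hκ.le hu.1, ?_⟩
  have := mul_le_mul_of_nonneg_left hu.2 hκ.le
  rwa [mul_div_cancel₀ _ hκ.ne'] at this

/-- `derivWithin` of `u ↦ c · f(κu)` on `[0, τ/κ]` in terms of `derivWithin f` on `[0, τ]` (`κ, τ > 0`). [folklore] -/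
theorem derivWithin_const_mul_comp_mul {f : ℝ → ℝ} {κ τ c : ℝ} (hκ : 0 < κ) (hτ : 0 < τ)
    (hf : ContDiffOn ℝ 1 f (Icc 0 τ)) {u : ℝ} (hu : u ∈ Icc 0 (τ / κ)) :
    derivWithin (fun s => c * f (κ * s)) (Icc 0 (τ / κ)) u = c * κ * derivWithin f (Icc 0 τ) (κ * u) := by
  have hmaps : MapsTo (fun s : ℝ => κ * s) (Icc 0 (τ / κ)) (Icc 0 τ) := fun s hs => mul_mem_Icc hκ hs
  have hd : HasDerivWithinAt f (derivWithin f (Icc 0 τ) (κ * u)) (Icc 0 τ) (κ * u) :=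
    (hf.differentiableOn_one (κ * u) (mul_mem_Icc hκ hu)).hasDerivWithinAt
  have hg : HasDerivWithinAt (fun s : ℝ => κ * s) κ (Icc 0 (τ / κ)) u := by
    simpa using ((hasDerivWithinAt_id u (Icc 0 (τ / κ))).const_mul κ)
  have hcomp : HasDerivWithinAt (fun s => f (κ * s)) (derivWithin f (Icc 0 τ) (κ * u) * κ) (Icc 0 (τ / κ)) u :=
    hd.comp u hg hmaps
  have hmul := hcomp.const_mul c
  rw [hmul.derivWithin (uniqueDiffOn_Icc (div_pos hτ hκ) u hu)]
  ring

/-- `C¹` is preserved by `u ↦ c · f(κu)`. [folklore] -/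
theorem contDiffOn_const_mul_comp_mul {f : ℝ → ℝ} {κ τ : ℝ} (c : ℝ) (hκ : 0 < κ)
    (hf : ContDiffOn ℝ 1 f (Icc 0 τ)) : ContDiffOn ℝ 1 (fun s => c * f (κ * s)) (Icc 0 (τ / κ)) := by
  have hmaps : MapsTo (fun s : ℝ => κ * s) (Icc 0 (τ / κ)) (Icc 0 τ) := fun s hs => mul_mem_Icc hκ hs
  have hg : ContDiffOn ℝ 1 (fun s : ℝ => κ * s) (Icc 0 (τ / κ)) := (contDiff_const.mul contDiff_id).contDiffOn
  exact contDiffOn_const.mul (hf.comp hg hmaps)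

/-- `t ↦ s + t` maps `[0, τ − s]` into `[0, τ]` (`0 ≤ s`). [folklore] -/
theorem add_mem_Icc {s τ t : ℝ} (hs : 0 ≤ s) (ht : t ∈ Icc 0 (τ - s)) : s + t ∈ Icc 0 τ :=
  ⟨by linarith [ht.1], by linarith [ht.2]⟩

/-- `derivWithin` of `t ↦ f(s + t)` on `[0, τ−s]` is `derivWithin f` on `[0, τ]` at `s + t` (`0 ≤ s < τ`). [folklore] -/
theorem derivWithin_comp_const_add {f : ℝ → ℝ} {s τ : ℝ} (hs : 0 ≤ s) (hsτ : s < τ)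
    (hf : ContDiffOn ℝ 1 f (Icc 0 τ)) {t : ℝ} (ht : t ∈ Icc 0 (τ - s)) :
    derivWithin (fun u => f (s + u)) (Icc 0 (τ - s)) t = derivWithin f (Icc 0 τ) (s + t) := by
  have hmaps : MapsTo (fun u : ℝ => s + u) (Icc 0 (τ - s)) (Icc 0 τ) := fun u hu => add_mem_Icc hs hu
  have hd : HasDerivWithinAt f (derivWithin f (Icc 0 τ) (s + t)) (Icc 0 τ) (s + t) :=
    (hf.differentiableOn_one (s + t) (add_mem_Icc hs ht)).hasDerivWithinAt
  have hg : HasDerivWithinAt (fun u : ℝ => s + u) 1 (Icc 0 (τ - s)) t := by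
    simpa using ((hasDerivWithinAt_id t (Icc 0 (τ - s))).const_add s)
  have hcomp : HasDerivWithinAt (fun u => f (s + u)) (derivWithin f (Icc 0 τ) (s + t) * 1) (Icc 0 (τ - s)) t :=
    hd.comp t hg hmaps
  rw [hcomp.derivWithin (uniqueDiffOn_Icc (by linarith) t ht), mul_one]

/-- `C¹` is preserved by `t ↦ f(s + t)`. [folklore] -/
theorem contDiffOn_comp_const_add {f : ℝ → ℝ} {s τ : ℝ} (hs : 0 ≤ s) (hf : ContDiffOn ℝ 1 f (Icc 0 τ)) :
    ContDiffOn ℝ 1 (fun u => f (s + u)) (Icc 0 (τ - s)) := by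
  have hmaps : MapsTo (fun u : ℝ => s + u) (Icc 0 (τ - s)) (Icc 0 τ) := fun u hu => add_mem_Icc hs hu
  exact hf.comp (contDiff_const.add contDiff_id).contDiffOn hmaps

/-- Exact zero-slack flows carry no phantom energy: `F = ½S²` on `[0, τ]`. [cite: Tao2016AveragedNS, §4 (4.10)] -/
theorem energy_eq {𝕊 : Finset (ℤ × ℤ × ℤ)} {τ ε₀ : ℝ} {α : Fin m → Fin m → Fin m → ℤ × ℤ × ℤ → ℝ}
    {S₀ : Fin m → ℤ → ℝ} {S F : Fin m → ℤ → ℝ → ℝ}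
    (h : PseudoFlowOnShift 𝕊 τ ε₀ α 0 0 S₀ (fun i k => (1 / 2) * S₀ i k ^ 2) (fun _ _ => 0) S F)
    (i : Fin m) (k : ℤ) {s : ℝ} (hs : s ∈ Icc 0 τ) : F i k s = (1 / 2) * S i k s ^ 2 := by
  have h1 := h.defect_lower i k s hs
  have h2 := h.defect_upper i k s hs
  simp only [zero_mul, add_zero] at h2
  linarith

/-- Exact flows satisfy the equation of motion with EQUALITY. [cite: Tao2016AveragedNS, §4 (4.8)] -/
theorem motion_eq {𝕊 : Finset (ℤ × ℤ × ℤ)} {τ ε₀ : ℝ} {α : Fin m → Fin m → Fin m → ℤ × ℤ × ℤ → ℝ}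
    {S₀ F₀ B₀ : Fin m → ℤ → ℝ} {S F : Fin m → ℤ → ℝ → ℝ} {κ₂ : ℝ}
    (h : PseudoFlowOnShift 𝕊 τ ε₀ α 0 κ₂ S₀ F₀ B₀ S F) (i : Fin m) (k : ℤ) {s : ℝ} (hs : s ∈ Icc 0 τ) :
    derivWithin (S i k) (Icc 0 τ) s = quadTermOn 𝕊 ε₀ α S i k s := by
  have hm := h.motion i k s hs
  simp only [zero_mul] at hm
  have := abs_nonpos_iff.mp hm
  linarith

/-! ### The two symmetries at the level of exact flows -/

/-- **SCALING COVARIANCE OF EXACT FLOWS.** If `(S, F)` is an exact zero-slack `𝕊`-flow at ratio `1+ε₀`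
(`1+ε₀ ≥ 0`) on `[0, τ]` (`τ > 0`) from `S₀`, then for every `κ > 0` the family `t ↦ κ S(κt)` with energies
`½(κS(κt))²` is an exact flow on `[0, τ/κ]` from `κ S₀`.
[cite: Tao2016AveragedNS, §4 Lemma 4.1 (4.5), (4.8)–(4.10) (displays; homogeneity of (4.8)); cell harvest/h2-tao-ladder] -/
theorem pseudoFlowOnShift_scale {𝕊 : Finset (ℤ × ℤ × ℤ)} {τ ε₀ : ℝ} (hε : 0 ≤ 1 + ε₀) (hτ : 0 < τ)
    {α : Fin m → Fin m → Fin m → ℤ × ℤ × ℤ → ℝ} {S₀ : Fin m → ℤ → ℝ} {S F : Fin m → ℤ → ℝ → ℝ}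
    (h : PseudoFlowOnShift 𝕊 τ ε₀ α 0 0 S₀ (fun i k => (1 / 2) * S₀ i k ^ 2) (fun _ _ => 0) S F)
    {κ : ℝ} (hκ : 0 < κ) :
    PseudoFlowOnShift 𝕊 (τ / κ) ε₀ α 0 0 (fun i k => κ * S₀ i k) (fun i k => (1 / 2) * (κ * S₀ i k) ^ 2)
      (fun _ _ => 0) (scaleFam κ S) (fun i k t => (1 / 2) * scaleFam κ S i k t ^ 2) := by
  have hcd : ∀ i k, ContDiffOn ℝ 1 (scaleFam κ S i k) (Icc 0 (τ / κ)) := fun i k =>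
    contDiffOn_const_mul_comp_mul κ hκ (h.contDiffOn_S i k)
  have hder : ∀ i k u, u ∈ Icc 0 (τ / κ) →
      derivWithin (scaleFam κ S i k) (Icc 0 (τ / κ)) u = quadTermOn 𝕊 ε₀ α (scaleFam κ S) i k u := by
    intro i k u hu
    have e : scaleFam κ S i k = fun s => κ * S i k (κ * s) := rfl
    rw [e, derivWithin_const_mul_comp_mul hκ hτ (h.contDiffOn_S i k) hu,
      motion_eq h i k (mul_mem_Icc hκ hu)]
    have := quadTermOn_scale_time 𝕊 ε₀ α κ S (fun s => κ * s) i k u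
    have e2 : (scaleFam κ S) = fun j k' t => κ * S j k' ((fun s => κ * s) t) := rfl
    rw [e2, this]
    ring
  have hw : ∀ k : ℤ, (0 : ℝ) ≤ 1 + (1 + ε₀) ^ ((10 : ℝ) * k) := fun k => by
    have := Real.rpow_nonneg hε ((10 : ℝ) * k)
    linarith
  obtain ⟨M, hM⟩ := h.apriori_S
  have hbound : ∀ u, u ∈ Icc 0 (τ / κ) → ∀ (i : Fin m) (k : ℤ),
      (1 + (1 + ε₀) ^ ((10 : ℝ) * k)) * |scaleFam κ S i k u| ≤ κ * M := by
    intro u hu i k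
    have hb := hM (κ * u) (mul_mem_Icc hκ hu) i k
    simp only [scaleFam, abs_mul, abs_of_pos hκ]
    calc (1 + (1 + ε₀) ^ ((10 : ℝ) * k)) * (κ * |S i k (κ * u)|)
        = κ * ((1 + (1 + ε₀) ^ ((10 : ℝ) * k)) * |S i k (κ * u)|) := by ring
      _ ≤ κ * M := mul_le_mul_of_nonneg_left hb hκ.le
  refine
    { contDiffOn_S := hcd
      contDiffOn_F := fun i k => contDiffOn_const.mul ((hcd i k).pow 2)
      nonneg_F := fun i k s _ => by positivity
      apriori_S := ⟨κ * M, hbound⟩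
      apriori_F := ⟨κ * M, fun u hu i k => ?_⟩
      init_S := fun i k => by simp [scaleFam, h.init_S i k]
      init_F := fun i k => by
        show (1 / 2 : ℝ) * scaleFam κ S i k 0 ^ 2 = 1 / 2 * (κ * S₀ i k) ^ 2
        simp [scaleFam, h.init_S i k]
      motion := fun i k u hu => by rw [hder i k u hu, sub_self, abs_zero, zero_mul, zero_mul]
      energy := fun i k u hu => ?_
      defect_lower := fun i k s hs => le_rfl
      defect_upper := fun i k s hs => by simp }
  · -- (4.5) energies: `√(½x²) ≤ |x|`
    have hx : Real.sqrt ((1 / 2) * scaleFam κ S i k u ^ 2) ≤ |scaleFam κ S i k u| := by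
      rw [show |scaleFam κ S i k u| = Real.sqrt (scaleFam κ S i k u ^ 2) from (Real.sqrt_sq_eq_abs _).symm]
      exact Real.sqrt_le_sqrt (by nlinarith [sq_nonneg (scaleFam κ S i k u)])
    exact (mul_le_mul_of_nonneg_left hx (hw k)).trans (hbound u hu i k)
  · -- (4.9) with equality
    have hd : HasDerivWithinAt (scaleFam κ S i k) (derivWithin (scaleFam κ S i k) (Icc 0 (τ / κ)) u)
        (Icc 0 (τ / κ)) u := ((hcd i k).differentiableOn_one u hu).hasDerivWithinAt
    have h2 : HasDerivWithinAt (fun t => (1 / 2 : ℝ) * scaleFam κ S i k t ^ 2)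
        ((1 / 2 : ℝ) * (((2 : ℕ) : ℝ) * scaleFam κ S i k u ^ (2 - 1) *
          derivWithin (scaleFam κ S i k) (Icc 0 (τ / κ)) u)) (Icc 0 (τ / κ)) u :=
      (hd.pow 2).const_mul (1 / 2 : ℝ)
    show derivWithin (fun t => (1 / 2 : ℝ) * scaleFam κ S i k t ^ 2) (Icc 0 (τ / κ)) u ≤
      quadTermOn 𝕊 ε₀ α (scaleFam κ S) i k u * scaleFam κ S i k u
    rw [h2.derivWithin (uniqueDiffOn_Icc (div_pos hτ hκ) u hu), hder i k u hu]
    norm_num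
    apply le_of_eq
    ring

/-- **TIME-TRANSLATION COVARIANCE OF EXACT FLOWS.** If `(S, F)` is an exact zero-slack `𝕊`-flow on `[0, τ]`
(`1+ε₀ ≥ 0`) from `S₀` and `0 ≤ s < τ`, then `t ↦ S(s+t)` with energies `½S(s+t)²` is an exact flow on
`[0, τ − s]` from `S(s)`. [cite: Tao2016AveragedNS, §4 Lemma 4.1 (4.5), (4.8)–(4.10) (displays; autonomy of (4.8)); cell harvest/h2-tao-ladder] -/
theorem pseudoFlowOnShift_translate {𝕊 : Finset (ℤ × ℤ × ℤ)} {τ ε₀ : ℝ} (hε : 0 ≤ 1 + ε₀)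
    {α : Fin m → Fin m → Fin m → ℤ × ℤ × ℤ → ℝ} {S₀ : Fin m → ℤ → ℝ} {S F : Fin m → ℤ → ℝ → ℝ}
    (h : PseudoFlowOnShift 𝕊 τ ε₀ α 0 0 S₀ (fun i k => (1 / 2) * S₀ i k ^ 2) (fun _ _ => 0) S F)
    {s : ℝ} (hs : 0 ≤ s) (hsτ : s < τ) :
    PseudoFlowOnShift 𝕊 (τ - s) ε₀ α 0 0 (fun i k => S i k s) (fun i k => (1 / 2) * S i k s ^ 2)
      (fun _ _ => 0) (translateFam s S) (fun i k t => (1 / 2) * translateFam s S i k t ^ 2) := by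
  have hcd : ∀ i k, ContDiffOn ℝ 1 (translateFam s S i k) (Icc 0 (τ - s)) := fun i k =>
    contDiffOn_comp_const_add hs (h.contDiffOn_S i k)
  have hder : ∀ i k u, u ∈ Icc 0 (τ - s) →
      derivWithin (translateFam s S i k) (Icc 0 (τ - s)) u =
        quadTermOn 𝕊 ε₀ α (translateFam s S) i k u := by
    intro i k u hu
    have e : translateFam s S i k = fun t => S i k (s + t) := rfl
    rw [e, derivWithin_comp_const_add hs hsτ (h.contDiffOn_S i k) hu, motion_eq h i k (add_mem_Icc hs hu)]
    rfl
  have hw : ∀ k : ℤ, (0 : ℝ) ≤ 1 + (1 + ε₀) ^ ((10 : ℝ) * k) := fun k => by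
    have := Real.rpow_nonneg hε ((10 : ℝ) * k)
    linarith
  obtain ⟨M, hM⟩ := h.apriori_S
  have hbound : ∀ u, u ∈ Icc 0 (τ - s) → ∀ (i : Fin m) (k : ℤ),
      (1 + (1 + ε₀) ^ ((10 : ℝ) * k)) * |translateFam s S i k u| ≤ M := fun u hu i k =>
    hM (s + u) (add_mem_Icc hs hu) i k
  refine
    { contDiffOn_S := hcd
      contDiffOn_F := fun i k => contDiffOn_const.mul ((hcd i k).pow 2)
      nonneg_F := fun i k s _ => by positivity
      apriori_S := ⟨M, hbound⟩
      apriori_F := ⟨M, fun u hu i k => ?_⟩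
      init_S := fun i k => by simp [translateFam]
      init_F := fun i k => by
        show (1 / 2 : ℝ) * translateFam s S i k 0 ^ 2 = 1 / 2 * S i k s ^ 2
        simp [translateFam]
      motion := fun i k u hu => by rw [hder i k u hu, sub_self, abs_zero, zero_mul, zero_mul]
      energy := fun i k u hu => ?_
      defect_lower := fun i k s hs => le_rfl
      defect_upper := fun i k s hs => by simp }
  · have hx : Real.sqrt ((1 / 2) * translateFam s S i k u ^ 2) ≤ |translateFam s S i k u| := by
      rw [show |translateFam s S i k u| = Real.sqrt (translateFam s S i k u ^ 2) from
        (Real.sqrt_sq_eq_abs _).symm]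
      exact Real.sqrt_le_sqrt (by nlinarith [sq_nonneg (translateFam s S i k u)])
    exact (mul_le_mul_of_nonneg_left hx (hw k)).trans (hbound u hu i k)
  · have hd : HasDerivWithinAt (translateFam s S i k) (derivWithin (translateFam s S i k) (Icc 0 (τ - s)) u)
        (Icc 0 (τ - s)) u := ((hcd i k).differentiableOn_one u hu).hasDerivWithinAt
    have h2 : HasDerivWithinAt (fun t => (1 / 2 : ℝ) * translateFam s S i k t ^ 2)
        ((1 / 2 : ℝ) * (((2 : ℕ) : ℝ) * translateFam s S i k u ^ (2 - 1) *
          derivWithin (translateFam s S i k) (Icc 0 (τ - s)) u)) (Icc 0 (τ - s)) u :=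
      (hd.pow 2).const_mul (1 / 2 : ℝ)
    show derivWithin (fun t => (1 / 2 : ℝ) * translateFam s S i k t ^ 2) (Icc 0 (τ - s)) u ≤
      quadTermOn 𝕊 ε₀ α (translateFam s S) i k u * translateFam s S i k u
    rw [h2.derivWithin (uniqueDiffOn_Icc (by linarith) u hu), hder i k u hu]
    norm_num
    apply le_of_eq
    ring

end FlowSymmetry

end Summit.NavierStokesRegularity.NavierStokesRegularity.Theorems

end
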